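/-
Copyright (c) 2026 the pub-hodgecm-mathlib formalisation cell (harness21).  Prover seat hodgecm-mathlib-LH4-p01 (g0): line LH4 (closer stub `stub_N6ns`, germ road
«N6nsGerm» ED. 1.16″), LEAD F0P3a-plan (g13) T12-7 ∕ T12-9 (1) «BY NAME statements file» — the re-export half; 2026-09-02.
-/
import Literature.NumberTheory.Rogawski1990.LocalTransferIdentityCoreResidualStatements   -- ★ (this seat): the three constants `N6nsS3ramStatement` ∕ `N6nsDyadicStatement` ∕ `N6nsShalikaStatement` (brings ★ p847670)
import HarnessLib

/-!
# [LanglandsShelstad1990Descent (2.1.2)] [Rogawski1990 §4.9 Prop. 4.9.1 (a); §8.1 Prop. 8.1.1] The three-way split of the identity core `stub_N6nsS3id`, re-exported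
# over the CLOSED CONSTANTS «S3-ram at `Φ₃`» · «DYADIC» · «Shalika at `Φ₃`»

Topic `NumberTheory/Rogawski1990`; namespace `Literature.NumberTheory.Rogawski1990`.  THEOREMS ONLY (no definition, no instance, no notation, no named fact, no `sorry`);
kernel lane `--supports stmt-HodgeConjecture-24833`.  Cell `pub/hodgecm-mathlib` (D-0151), crux H413; line LH4 (germ road «N6nsGerm» of the closer stub `stub_N6ns`); LEAD
F0P3a-plan (g13) T12-9 (1): ONE re-export `n6nsS3id_of_statements : N6nsS3ramStatement → N6nsDyadicStatement → N6nsShalikaStatement → ‹the stub_N6nsS3id text›` = ★ p847670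
`n6nsS3id_of_tameRamAntidiag_of_dyadic_of_shalikaAntidiag` (F0P3b-p01 (g14)) applied to the three hypotheses — the constants (★ `LocalTransferIdentityCoreResidualStatements`, the
statements-only sibling) unfold by `delta`, so the ★ term elaborates unchanged.  Consumers: the germ ED. 1.17 ∕ the H-FORM head (F0P3b-p01) and, BY NAME, the closer ED. 39
§2‴ swap (desk F0P3-plan (g13) D55-pre (E), LEAD T12-7).

HONEST LABEL: HC_CM is proved only modulo the 7 printed citations (2 remaining named inputs: hLiu418 = stmt-HodgeConjecture-24832, h413 = stmt-HodgeConjecture-24833) until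
rung 0 closes; this file re-exports a ★ theorem over named hypotheses — CONDITIONAL on «DYADIC» ([LS₂] at `v ∣ 2`) and «SHALIKA» ([Rogawski1990 Prop. 8.1.1]) and on the
in-house socket «S3-RAM» until the fold is ★; nothing printed is discharged; books count-neutral.

## References
* [Rogawski1990] J. D. Rogawski, *Automorphic Representations of Unitary Groups in Three Variables*, Ann. of Math. Stud. 123 (1990): §4.9 Prop. 4.9.1 (a) p. 55; §8.1
  Props. 8.1.1–8.1.2 pp. 112–114; §14.4 p. 237.
* [LanglandsShelstad1990Descent] R. P. Langlands, D. Shelstad, *Descent for transfer factors*, The Grothendieck Festschrift II, Progr. Math. 87 (1990): §2.1 (2.1.2).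
-/

set_option autoImplicit false

noncomputable section

open NumberField IsDedekindDomain MeasureTheory Measure Topology Filter
open Literature.NumberTheory.Rogawski1990 Literature.NumberTheory.Automorphic Literature.NumberTheory.GaloisRepresentations
open Literature.NumberTheory.Automorphic.UnitaryGroup Literature.NumberTheory.Automorphic.IntegralReduction
open Literature.AlgebraicGeometry.ShimuraVarieties (unitaryGroup hermForm)
open scoped Matrix MatrixGroups Classical ValuativeRel

namespace Literature.NumberTheory.Rogawski1990

/-! ## §1 The three-way split over the constants (★ p847670 re-exported BY NAME) -/

/-- **`stub_N6nsS3id` ⟸ «S3-RAM AT `Φ₃`» + «DYADIC» + «SHALIKA AT `Φ₃`», over the three constants** — ★ `n6nsS3id_of_tameRamAntidiag_of_dyadic_of_shalikaAntidiag` (F0P3b-p01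
(g14), p847670) applied to the unfolded constants (they unfold by `delta`): at every non-split place `v` of `L⁺` — `v ∣ 2` → DYADIC; `v ∤ 2` unramified → SHALIKA alone (★
`s3id_of_shalikaAntidiag`); `v ∤ 2` ramified → frame ★ (H2) + descent over S3-RAM at `Φ₃`.  The conclusion is the germ line's `stub_N6nsS3id` text verbatim.
[cite: LanglandsShelstad1990Descent, §2.1 (2.1.2)] [cite: Rogawski1990, §8.1 Props. 8.1.1–8.1.2 pp. 112–114; §4.9 Prop. 4.9.1 p. 55; §14.4 p. 237] -/
theorem n6nsS3id_of_statements :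
    N6nsS3ramStatement → N6nsDyadicStatement → N6nsShalikaStatement →
    ∀ (L : Type) [Field L] [NumberField L] [IsCMField L] (H' : Matrix (Fin 3) (Fin 3) L) (μ : HeckeCharacter L)
      [∀ v : HeightOneSpectrum (𝓞 ↥(maximalRealSubfield L)),
        MeasurableSpace ((UnitaryGroup.cmDatum L 2 (Matrix.of fun i j : Fin 2 => if i.val + j.val + 1 = 2 then (1 : L) else 0)).Local v ×
          (UnitaryGroup.cmDatum L 1 (Matrix.of fun i j : Fin 1 => if i.val + j.val + 1 = 1 then (1 : L) else 0)).Local v)]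
      [∀ v : HeightOneSpectrum (𝓞 ↥(maximalRealSubfield L)),
        BorelSpace ((UnitaryGroup.cmDatum L 2 (Matrix.of fun i j : Fin 2 => if i.val + j.val + 1 = 2 then (1 : L) else 0)).Local v ×
          (UnitaryGroup.cmDatum L 1 (Matrix.of fun i j : Fin 1 => if i.val + j.val + 1 = 1 then (1 : L) else 0)).Local v)]
      [∀ v : HeightOneSpectrum (𝓞 ↥(maximalRealSubfield L)), MeasurableSpace ((UnitaryGroup.cmDatum L 3 H').Local v)]
      [∀ v : HeightOneSpectrum (𝓞 ↥(maximalRealSubfield L)), BorelSpace ((UnitaryGroup.cmDatum L 3 H').Local v)]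
      (νH : ∀ v : HeightOneSpectrum (𝓞 ↥(maximalRealSubfield L)),
        Measure ((UnitaryGroup.cmDatum L 2 (Matrix.of fun i j : Fin 2 => if i.val + j.val + 1 = 2 then (1 : L) else 0)).Local v ×
          (UnitaryGroup.cmDatum L 1 (Matrix.of fun i j : Fin 1 => if i.val + j.val + 1 = 1 then (1 : L) else 0)).Local v))
      (νG : ∀ v : HeightOneSpectrum (𝓞 ↥(maximalRealSubfield L)), Measure ((UnitaryGroup.cmDatum L 3 H').Local v))
      [∀ v, (νH v).IsHaarMeasure] [∀ v, (νH v).IsMulRightInvariant] [∀ v, (νG v).IsHaarMeasure] [∀ v, (νG v).IsMulRightInvariant],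
      μ.IsUnitary →
      (∀ x : ideleGroup ↥(maximalRealSubfield L), μ (AdeleRing.ideleBaseChange (↥(maximalRealSubfield L)) L x) = quadraticHeckeCharCM L x) →
      (H'.map (cmConjRingHom L)).transpose = H' →
      (∀ x : Fin 3 → L, Literature.AlgebraicGeometry.ShimuraVarieties.hermForm (cmConjRingHom L) H' x x = 0 → x = 0) →
      ∀ (v : HeightOneSpectrum (𝓞 ↥(maximalRealSubfield L))), Subsingleton (UnitaryGroup.PlacesOver L v) →
      ∀ [_iH : ∀ a : ((UnitaryGroup.cmDatum L 2 (Matrix.of fun i j : Fin 2 => if i.val + j.val + 1 = 2 then (1 : L) else 0)).Local v × (UnitaryGroup.cmDatum L 1 (Matrix.of fun i j : Fin 1 => if i.val + j.val + 1 = 1 then (1 : L) else 0)).Local v),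
          MeasurableSpace (((UnitaryGroup.cmDatum L 2 (Matrix.of fun i j : Fin 2 => if i.val + j.val + 1 = 2 then (1 : L) else 0)).Local v × (UnitaryGroup.cmDatum L 1 (Matrix.of fun i j : Fin 1 => if i.val + j.val + 1 = 1 then (1 : L) else 0)).Local v) ⧸
            Subgroup.centralizer ({a} : Set ((UnitaryGroup.cmDatum L 2 (Matrix.of fun i j : Fin 2 => if i.val + j.val + 1 = 2 then (1 : L) else 0)).Local v × (UnitaryGroup.cmDatum L 1 (Matrix.of fun i j : Fin 1 => if i.val + j.val + 1 = 1 then (1 : L) else 0)).Local v)))]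
        [_bH : ∀ a : ((UnitaryGroup.cmDatum L 2 (Matrix.of fun i j : Fin 2 => if i.val + j.val + 1 = 2 then (1 : L) else 0)).Local v × (UnitaryGroup.cmDatum L 1 (Matrix.of fun i j : Fin 1 => if i.val + j.val + 1 = 1 then (1 : L) else 0)).Local v),
          BorelSpace (((UnitaryGroup.cmDatum L 2 (Matrix.of fun i j : Fin 2 => if i.val + j.val + 1 = 2 then (1 : L) else 0)).Local v × (UnitaryGroup.cmDatum L 1 (Matrix.of fun i j : Fin 1 => if i.val + j.val + 1 = 1 then (1 : L) else 0)).Local v) ⧸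
            Subgroup.centralizer ({a} : Set ((UnitaryGroup.cmDatum L 2 (Matrix.of fun i j : Fin 2 => if i.val + j.val + 1 = 2 then (1 : L) else 0)).Local v × (UnitaryGroup.cmDatum L 1 (Matrix.of fun i j : Fin 1 => if i.val + j.val + 1 = 1 then (1 : L) else 0)).Local v)))]
        [_iG : ∀ γ : ((UnitaryGroup.cmDatum L 3 H').Local v), MeasurableSpace (((UnitaryGroup.cmDatum L 3 H').Local v) ⧸ Subgroup.centralizer ({γ} : Set ((UnitaryGroup.cmDatum L 3 H').Local v)))]
        [_bG : ∀ γ : ((UnitaryGroup.cmDatum L 3 H').Local v), BorelSpace (((UnitaryGroup.cmDatum L 3 H').Local v) ⧸ Subgroup.centralizer ({γ} : Set ((UnitaryGroup.cmDatum L 3 H').Local v)))]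
        (mH : OrbitalMeasureFamily ((UnitaryGroup.cmDatum L 2 (Matrix.of fun i j : Fin 2 => if i.val + j.val + 1 = 2 then (1 : L) else 0)).Local v × (UnitaryGroup.cmDatum L 1 (Matrix.of fun i j : Fin 1 => if i.val + j.val + 1 = 1 then (1 : L) else 0)).Local v))
        (mG : OrbitalMeasureFamily ((UnitaryGroup.cmDatum L 3 H').Local v)),
      mH.IsCanonical (IsLocalGRegular L v) (νH v) → mG.IsCanonical (fun γ => IsRegularElt (γ.val : GL (Fin 3) (UnitaryGroup.LocalRing L v))) (νG v) →
      ∀ (φ : ((UnitaryGroup.cmDatum L 3 H').Local v) → ℂ), IsLocSmooth φ →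
        ∃ V ∈ 𝓝 (1 : ((UnitaryGroup.cmDatum L 2 (Matrix.of fun i j : Fin 2 => if i.val + j.val + 1 = 2 then (1 : L) else 0)).Local v × (UnitaryGroup.cmDatum L 1 (Matrix.of fun i j : Fin 1 => if i.val + j.val + 1 = 1 then (1 : L) else 0)).Local v)), ∃ φH : ((UnitaryGroup.cmDatum L 2 (Matrix.of fun i j : Fin 2 => if i.val + j.val + 1 = 2 then (1 : L) else 0)).Local v × (UnitaryGroup.cmDatum L 1 (Matrix.of fun i j : Fin 1 => if i.val + j.val + 1 = 1 then (1 : L) else 0)).Local v) → ℂ, IsLocSmooth φH ∧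
          ∀ γH ∈ V, IsLocalGRegular L v γH →
            stableOrbitalIntegralRel (IsLocalStablyConjH L v) mH φH γH =
              ∑ᶠ c : ConjClasses ((UnitaryGroup.cmDatum L 3 H').Local v), ((finExplicitCollection L H' μ (finExplicitDelta_conj_left_all L H' μ) (finExplicitDelta_conj_right_all L H' μ)) v).Δ γH (Quotient.out c) * classOrbitalIntegral mG φ c :=
  fun hram hdy hsh => n6nsS3id_of_tameRamAntidiag_of_dyadic_of_shalikaAntidiag hram hdy hsh

end Literature.NumberTheory.Rogawski1990

end
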